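import Mathlib
import HarnessLib
import HarnessLib.Audit
import Summits.ABC.Statement
import HarnessLib.Audit.Status.Attr

/-!
Route: parity-slice-concordant-norms

DORMANT since 2026-08-24T14:51:12Z (reconciler: no traction for 6.8 d (last activity item-evidence-added at 2026-08-17T18:12:31Z); parked, not closed — `ledger route dormant route-ABC-parity-slice-concordant-norms --off` to reactivate) — unstaffed, not closed; items shared with open routes are served there. `ledger route dormant <id> --off` reactivates.

THESIS (X = "it suffices to show X").  X := NonSquareTopABC: the abc inequality for abc triples
whose top c is NOT a perfect square:
  ∀ ε>0 ∃ C>0 ∀ coprime 0<a,b, a+b=c, ¬IsSquare c:  c < C·rad(abc)^(1+ε).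
Lean (over Literature.NumberTheory.DiophantineGeometry.IsABCTriple / rad and the summit constant
ABC):
  def NonSquareTopABC : Prop := ∀ ε : ℝ, 0 < ε → ∃ C : ℝ, 0 < C ∧ ∀ a b c : ℕ, IsABCTriple a b c → ¬
IsSquare c → (c:ℝ) < C * (rad a b c : ℝ) ^ (1 + ε)
Card: ABC/ABC/parity-slice-concordant-norms.  In the card's language: write a=a₀α², b=b₀β², c=c₀γ²
(a₀,b₀,c₀ squarefree: the
2-pattern / parity slice σ; (α:β:γ) a primitive point of the conic a₀x²+b₀y²=c₀z², whose three norm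
forms live in the three quadratic
subfields of L_σ=ℚ(√−a₀b₀,√a₀c₀)).  X says: in every slice with c₀>1 no primitive vector has three
radically poor CONCORDANT NORMS,
uniformly in σ.  The slices with c₀=1 (c a square: where the textbook near-miss families
(1,u^2k−1,u^2k), all Pythagorean triples of squares and
all quadratic 'triples-from-triples' images live) are DISCARDED: the Assembly proves NonSquareTopABC
→ SquareTopResidualFinite → ABC by six
explicit cubic/quartic Belyi breedings that turn any square-top triple into a non-square-top triple
of comparable quality
(c' ≥ c^d/81, rad' ≤ 18 c^(d−1) rad, d∈{3,4}), except on an explicit residual set lying on eight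
smooth genus-5 curves (finite by
Faltings; empty for c ≤ 4·10^4 by direct check; conjecturally empty).  Frey dictionary: square top
with a square leg ⟺ the Frey curve
has a rational 4-torsion point; X is abc for Frey curves with no rational cyclic 4-subgroup through
(a,0)/(−b,0) — the breeding trades
ℤ/2×ℤ/4, ℤ/2×ℤ/8 Frey curves for ℤ/2×ℤ/2 ones.

Rationale: WHY THIS LINE.  The card (parity layer: abc ⟺ slice-uniform Langevin for the 3-parameter family of
conic sextics ⟺ 'three
concordant norms never simultaneously radically poor') is a coordinate system plus an unconditional
density theorem; its own
target K2 restates S (refuter audit).  Planner analysis sharpened this into a dichotomy of slices: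
SPECIAL slices (the conic meets
the coordinate triangle in a rational point ⟺ c=□ ∧ (a=□ ∨ b=□)) are exactly the images of the
quadratic 'triples from triples'
identities (a²,b(a+c),c²),(4ab,(a−b)²,c²) [deWeger2023Fudge §3.6] — breeding SINKS (slice (1,1,1)
alone, and the union of the
c₀=1 slices, are ABC-complete); GENERIC slices
(S₆(ℚ)=∅) are individually breeding-IMMUNE (a Belyi map ψ/ℚ transferring quality must have
ψ({0,1,∞})⊂{0,1,∞} by the
Riemann–Hurwitz count d+2, and would need ψ(0),ψ(1),ψ(∞)∈S₆(ℚ)=∅).  The new move is the converse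
transfer OUT of the sinks:
degree-3/4 Belyi identities  𝔅: c(2b−a)²+a²(3b−a)=4b³ [a<3b],  𝔊: a³(a−2b)+b³(2a−b)=c(a−b)³ [a>2b],
ℌ: a(a+2b)³+b³(2a+3b)=c³(a+3b), and their a↔b mirrors, whose tops have square class b₀, (a−b),
(a+3b)·{1,3}: for every
square-top triple one of them yields a NON-square top (2- and 3-adic bookkeeping of the gcd done;
verified on all 1.66·10^6
coprime square-top triples with c ≤ 4·10^4, residual EMPTY there), with ε' = ε/10.  Hence abc
reduces to non-square tops
(Target), i.e. to the slices with c₀>1, up to SquareTopResidualFinite (eight smooth complete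
intersections of three diagonal
quadrics in ℙ⁴, all 3×3 minors non-zero ⇒ genus 5 ⇒ Faltings1983Endlichkeit).  Imported areas:
dessins/Belyi maps
(Elkies1991ABCMordell, Langevin1993, BombieriGubler2006 §12.2), Campana-conic fibration
(BrowningValckenborgh2012),
power-free sieves / determinant method (doi:10.1093/qmath/43.1.45, arXiv:1505.05587,
Heathbrown2002), exceptional-set counting
(BernertBrowningLichtmanTeravainen2024, Lichtman2025, Kane2015).
RANKED CRUXES (two layers; glue later).
 rank 2  GenericSliceLangevin — abc inside EACH slice σ=(a₀,b₀,c₀), c₀>1, constant C(σ,ε): Langevin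
for one conic sextic with
         S₆(ℚ)=∅; the breeding-immune core; already open for σ=(1,2,3).  [B–G Thm 12.2.12;
Langevin1993; Stewart2013]
 rank 3  SliceUniformity — GenericSliceLangevin → NonSquareTopABC (sub-polynomial dependence of
C(σ,ε) on |σ|=a₀b₀c₀; a |σ|^κ loss
         gives only c ≪ rad^(1+ε+κ)).  [EvertseGyory2015 §4; BombieriGubler2006 Lemma 12.2.11]
 rank 4  SliceHitsSubpolynomial — per slice, #{hits rad<c with γ≤Y} ≪_σ,δ Y^δ (heuristic truth; the
quantitative shadow of rank 2;
         engines: lattice counting, uniform conic/elliptic point counts).  [Heathbrown2002;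
BombieriZannier2004; Kane2015]
SUPPORT.  SliceAlmostAllHits (the card's (P2): ≪_σ,δ Y^(7/8+δ) of the ≍Y slice members with γ≤Y are
hits; elementary: hits force
P/rad(P) ≫ min|Q_i| for the powerful part P of Q₁Q₂Q₃(m,n); large p²|Q_i ⇒ ≪ X²/p²+1 primitive
lattice points; else a powerful
divisor q'∈[X^½,X^{3/2}] ⇒ Σ τ-weighted X²/q'+1; X=Y^½) — provable now, first 'abc almost surely'
INSIDE an N^½-size family;
SquareTopResidualFinite (load-bearing; Faltings, or elementary descent — open which); Assembly
(provable now: algebra + rpow).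
KILL CRITERIA.  A slice with c₀>1 carrying infinitely many triples of quality ≥1+ε refutes rank 2, X
and ABC together (none can be
refuted short of ¬abc); rank 4 dies if some slice has ≫Y^c hits (kit census of slices
(1,1,1),(1,2,3),(2,109,23) up to Y=10^7 is the
cheap test); SquareTopResidualFinite dies only with Faltings; an error in the six-map case analysis
would break the Assembly — the
exhaustive check to 4·10^4 and the 2- /3-adic gcd analysis in NOTES are the guard.  The route is
CLOSED as vacuous if a refuter shows
NonSquareTopABC is reducible to ABC by an equally cheap breeding in the other direction that makes
the Target literally S (it is
S-complete via the Assembly, by design; the content is the reduction and the slice programme below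
it).
NOT DECOMPOSED YET.  No split of rank 2 (per-slice Langevin) until SliceAlmostAllHits and the
Assembly land; K3 of the card
(two square-rich norms) is dropped as misstated (positive-rank concordant twists carry infinitely
many primitive (m,n)); its
bounded-height form is inside rank 4.  Cross-field catalogue used: geometric lift (dessins/Belyi),
sieve/counting; no spectral or
physical analogy.

Novelty: Searched 2026-08-15: lit search --hybrid 'abc Belyi transfer new triples from old' (B–G ch.12
pp.395–402 READ: Thm 12.2.9
Elkies–Langevin Belyi mechanism, Lemma 12.2.11, Thm 12.2.12 abc ⟹ rad F(m,n) ≫ H^(d−2−ε), F=xy(x+y)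
recovers abc); zbMATH 'abc
conjecture triples' (30 rows: BrowkinBrzezinski1994, deWeger2023Fudge arXiv:2301.03050 §3.6 READ
'triples from triples' = the
quadratic identities (a²,bd,c²),(b²,4ac,d²) attributed to van der Horst; Barrios2023
doi:10.1016/j.jnt.2022.07.009 READ pp.2–4:
good triples/curves WITH each Mazur torsion — the direction INTO torsion families;
BernertBrowningLichtmanTeravainen2024 and
Lichtman2025 READ: global exceptional set O(X^{33/50}), O(N^{2/3}), Mazur/Kane refined counts —
blind to N^½-size slices);
zbMATH 'power-free values binary forms' (Greaves 1992 doi:10.1093/qmath/43.1.45, Stewart–Top 1995,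
Xiao arXiv:1505.05587);
card audit prior: BrowningValckenborgh2012 (Campana conic fibration = the slice coordinates).
Galaxy (--star all/pdf) saturated
(3 attempts, queued >90 s); arXiv/OpenAlex APIs 429.  NOT FOUND: (i) the reduction 'abc ⟸ abc for
non-square c, up to a
Faltings-finite explicit residual' via cubic/quartic Belyi identities steering square classes
(nearest: deWeger2023Fudge §3.6 and
Elkies1991ABCMordell/Langevin1993 supply the mechanism, Barrios2023 the torsion dictionary in the
opposite direction); (ii) the
special/generic slice dichotomy (breeding sinks vs Riemann–Hurwitz-immune slices); (iii) per-slice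
almost-all abc with  [refs: 10.1016/j.jnt.2022.07.009, 10.1093/qmath/43.1.45, 2301.03050, 1505.05587, doi:10.1016/j.jnt.2022.07.009, doi:10.1093/qmath/43.1.45, BrowkinBrzezinski1994, Barrios2023, BernertBrowningLichtmanTeravainen2024, Lichtman2025, BrowningValckenborgh2012, Langevin1993]

Barriers (technique_class: belyi-breeding parity-slicing conic-langevin powerfree-sieve): technique_class: belyi-breeding parity-slicing conic-langevin powerfree-sieve
- Literature.Barriers.ABC.BakerMethodBounds: applies to rank 2/3 (any individual lower bound rad
F_σ(m,n) ≫ H^θ by logarithmic forms is (log H)^c-shaped); the route does not claim to evade it —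
rank 2 is posted as the breeding-immune core where a non-Baker input is needed; the Assembly,
SliceAlmostAllHits and rank 4 use no transcendence (algebraic identities, lattice/sieve counting).
- Literature.Barriers.ABC.EpsilonCannotBeDropped: respected — Target and cruxes keep ε and C(ε); the
breeding bookkeeping degrades ε ↦ ε/10, never to 0; hit counts (rank 4, support) are density
statements consistent with infinitely many hits per slice (Pell cusp families give ≫ log Y).
- Literature.Barriers.ABC.ExplicitABCQualityFloor: no exception-free inequality is asserted;
Reyssat's triple (2,3^10·109,23^5) has non-square top and stays in the Target's scope as one point
of slice (2,109,23).
- Literature.Barriers.ABC.HallExponentSharp: Danilov/Hall families are square-top or cusp families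
with quality → 1; they calibrate rank 4 (log Y hits) and are discarded or harmless, never
contradicted.
- Literature.Barriers.ABC.IntegersHaveNoDerivation: Riemann–Hurwitz/Belyi is used on honest maps
ℙ¹→ℙ¹ over ℚ acting on integer triples (as in Elkies1991ABCMordell), not as a function-field
transfer of Mason–Stothers to ℤ.
- Literature.Barriers.ABC.NConjectureExponentSharp, TijdemanZagierNeedsExponentThree, UniformABC*,
IUTDispute

History (route lifecycle, newest last):
- 2026-08-16T02:17:48Z · AUTO-CRUX: 1 conjecture-grade item(s) promoted to crux (SquareTopResidualFinite) — refuter vetting / tiering apply (operator:999:1362873)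
- 2026-08-16T03:41:27Z · AUTO-CRUX (backfill): NonSquareTopABC — hypotheses of the deciding theorem that nothing in the route derives are cruxes (operator:999:586464)
- 2026-08-24T14:51:12Z · DORMANT — reconciler: no traction for 6.8 d (last activity item-evidence-added at 2026-08-17T18:12:31Z); parked, not closed — `ledger route dormant route-ABC-parity-slice (operator:999:2360237)

sub-problem: ABC · status: dormant · opened planner-plancard-ABC-ABC-parity-slice-concord-ba3b8f4c-0 2026-08-15T11:27:00Z · rev 3 · ledger route-ABC-parity-slice-concordant-norms
GENERATED by the gate from the ledger (D-0016/17). Provers cite these decls: `theorem foo : Summit.ABC.ABC.Theses.ParitySliceConcordantNorms.<Decl> := …` in Summits/ABC/ABC/Theorems/<Name>.lean.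
-/

namespace Summit.ABC.ABC.Theses.ParitySliceConcordantNorms

open scoped BigOperators Topology Manifold Classical MeasureTheory ProbabilityTheory Matrix InnerProductSpace ComplexConjugate ContinuousMap
open Filter Set Function TopologicalSpace MeasureTheory

attribute [summit_statement] _root_.ABC

open Literature.Abc

/-- item stmt-ABC-4010 · crux (kind.auto-crux: conjecture-grade) · rank 0 · open · by planner
why it might fail: auto-crux — underived-target: the deciding theorem assumes it and nothing in the route derives it, so it is a bet, not glue
sources: BombieriGubler2006, Langevin1993, deWeger2023Fudge
[target] abc for abc triples whose top c is not a perfect square (⟺ parity slices with c₀>1 ⟺ 'three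
concordant norms never simultaneously radically poor' with non-trivial c₀). S-complete BY DESIGN via
the Assembly (six Belyi breedings + a Faltings-finite residual); implied by ABC trivially. Card
ABC/ABC/parity-slice-concordant-norms; B–G Conj. 12.2.2. -/
@[route_item "route-ABC-parity-slice-concordant-norms", crux]
def NonSquareTopABC : Prop :=
  ∀ ε : ℝ, 0 < ε → ∃ C : ℝ, 0 < C ∧ ∀ a b c : ℕ, Literature.NumberTheory.DiophantineGeometry.IsABCTriple a b c → ¬ IsSquare c → (c : ℝ) < C * ((Literature.NumberTheory.DiophantineGeometry.rad a b c : ℕ) : ℝ) ^ (1 + ε)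

/-- item stmt-ABC-4011 · crux · rank 2 · open · by planner
why it might fail: Needs a power-saving lower bound for rad of the values of ONE fixed sextic norm-form product; all proved inputs are Baker-shaped ((log H)^c), and even the cusp (Pell, x=1) families need rad(u_n) >= u_n^(1-eps) for Lucas sequences (open; Stewart 2013). False iff abc fails inside a c0>1 slice.
sources: BombieriGubler2006, Langevin1993, Stewart2013, StewartYu2001
[crux] Per-slice abc: for each parity slice σ=(a₀,b₀,c₀) (Squarefree(a₀b₀c₀), c₀>1) and ε>0 a
constant C(σ,ε) with c₀z² < C·rad^(1+ε) for all abc triples (a₀x²,b₀y²,c₀z²). Equivalently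
Langevin's bound rad F_σ(m,n) ≫ H^(4−ε) for ONE conic sextic F_σ=Q₁Q₂Q₃ (chord parametrisation of
a₀x²+b₀y²=c₀z²) with S₆(ℚ)=∅ — such a slice cannot receive bred triples (Riemann–Hurwitz), so this
is a genuine weakening of S, open already for σ=(1,2,3). WHY IT MIGHT FAIL: false iff abc fails
inside one c₀>1 slice; as a STEP it needs a power lower bound for radicals of values of a fixed
form, where every proved tool is Baker-shaped ((log H)^c: BakerMethodBounds; Lucas/Pell cusp
families x=1 need rad(u_n) ≥ u_n^(1−ε), open — Stewart2013 gives exp(log n/(104 log log n))).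
Sources: BombieriGubler2006 Thm 12.2.12 p.400; Langevin1993; Stewart2013; StewartYu2001. -/
@[route_item "route-ABC-parity-slice-concordant-norms"]
def GenericSliceLangevin : Prop :=
  ∀ a₀ b₀ c₀ : ℕ, Squarefree (a₀ * b₀ * c₀) → 1 < c₀ → ∀ ε : ℝ, 0 < ε → ∃ C : ℝ, 0 < C ∧ ∀ x y z : ℕ, Literature.NumberTheory.DiophantineGeometry.IsABCTriple (a₀ * x ^ 2) (b₀ * y ^ 2) (c₀ * z ^ 2) → ((c₀ * z ^ 2 : ℕ) : ℝ) < C * ((Literature.NumberTheory.DiophantineGeometry.rad (a₀ * x ^ 2) (b₀ * y ^ 2) (c₀ * z ^ 2) : ℕ) : ℝ) ^ (1 + ε)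

/-- item stmt-ABC-4012 · crux · rank 3 · open · by planner
why it might fail: Per-form constants in all known bounds grow with the height of F_sigma / the regulator of L_sigma (~|sigma|^(1/2)) in the exponent; a |sigma|^kappa loss collapses the conclusion to weak abc (c << rad^(1+eps+kappa)); generic slices are breeding-immune, so no slice inherits another's constant.
sources: EvertseGyory2015, BombieriGubler2006, Gyory2008
[crux] Uniformity across slices: GenericSliceLangevin → NonSquareTopABC, i.e. the per-slice
constants C(σ,ε) may be taken ≤ C'(ε')·(a₀b₀c₀)^(ε') (any |σ|^κ loss with fixed κ only yields c ≪
rad^(1+ε+κ), weak abc, since a₀b₀c₀ ≤ rad). WHY IT MIGHT FAIL: every known per-form bound carries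
the height/discriminant of F_σ (regulator of the biquadratic field L_σ ≍ |σ|^(1/2+o(1)))
multiplicatively in the exponent (B–G Lemma 12.2.11: D = D(height f)); no mechanism moves constants
between generic slices (each is breeding-immune), so uniformity is a separate, possibly harder,
statement. Sources: EvertseGyory2015 §4; BombieriGubler2006 Lemma 12.2.11; Gyory2008. -/
@[route_item "route-ABC-parity-slice-concordant-norms"]
def SliceUniformity : Prop :=
  GenericSliceLangevin → NonSquareTopABC

/-- item stmt-ABC-4013 · crux · rank 4 · open · by planner
why it might fail: Needs Y^eps point counts, uniform in the twist d <= Y, on the concordant genus-1 curves Q_i = d_i*sq, Q_j = d_j*sq; uniform X^eps counting on elliptic curves is open (Bombieri-Zannier X^(c/loglog X), Heath-Brown X^(1/2+eps)). A slice with many low-height points on many twists gives Y^c hits.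
sources: Heathbrown2002, BombieriZannier2004, Kane2015, BernertBrowningLichtmanTeravainen2024, doi:10.1093/qmath/43.1.45, arXiv:1505.05587
[crux] Per-slice hit count is sub-polynomial: for each slice σ and δ>0, #{abc triples
(a₀x²,b₀y²,c₀z²) with z ≤ Y and rad(abc) < c} ≤ C(σ,δ)·Y^δ (of ≍Y members). Heuristic truth (a hit
in the bulk forces P/rad(P) ≥ X² for the powerful part of Q₁Q₂Q₃(m,n), probability X^(−2+o(1)) over
X² vectors, X=Y^½; cusp/Pell families add (log Y)^O(1)). Sharpening of SliceAlmostAllHits (exponent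
7/8): beyond the lattice range one must count, uniformly in d ≤ Y, rational points of height ≤ Y on
the concordant genus-1 curves Q_i=d_i□, Q_j=d_j□ (two square-rich norms) and three-way square-rich
splittings d₁d₂d₃ ≤ X². WHY IT MIGHT FAIL: uniform Y^ε counting of rational points on elliptic
curves is open (BombieriZannier2004: Y^(c/log log Y) per curve; Heathbrown2002: B^(2/d+ε) uniformly,
= Y^(1/2+ε) here); a slice whose twists have anomalously many low-height points for many d could
give Y^c hits. Sources: Heathbrown2002; BombieriZannier2004; Kane2015;
BernertBrowningLichtmanTeravainen2024; doi:10.1093/qmath/43.1.45; arXiv:1505.05587. -/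
@[route_item "route-ABC-parity-slice-concordant-norms"]
def SliceHitsSubpolynomial : Prop :=
  ∀ a₀ b₀ c₀ : ℕ, Squarefree (a₀ * b₀ * c₀) → ∀ δ : ℝ, 0 < δ → ∃ C : ℝ, ∀ Y : ℕ, 2 ≤ Y → (Set.ncard {t : ℕ × ℕ × ℕ | Literature.NumberTheory.DiophantineGeometry.IsABCTriple (a₀ * t.1 ^ 2) (b₀ * t.2.1 ^ 2) (c₀ * t.2.2 ^ 2) ∧ t.2.2 ≤ Y ∧ Literature.NumberTheory.DiophantineGeometry.rad (a₀ * t.1 ^ 2) (b₀ * t.2.1 ^ 2) (c₀ * t.2.2 ^ 2) < c₀ * t.2.2 ^ 2} : ℝ) ≤ C * (Y : ℝ) ^ δ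

/-- item stmt-ABC-4015 · crux (kind.auto-crux: conjecture-grade) · rank 9 · open · by planner
why it might fail: auto-crux — conjecture-grade statement (docstring avows it ('conjecturally')); it is open, so it may simply be false
sources: Faltings1983Endlichkeit, deWeger2023Fudge
[support] (load-bearing glue for the Assembly) The set of square-top abc triples on which all six
breedings fail is finite: R⁺ = {(a,b,c): c=□ ∧ (b=□ ∨ 3b≤a) ∧ (a=□ ∨ 3a≤b) ∧ (a+3b ∈ {□,3□}) ∧ (3a+b
∈ {□,3□}) ∧ (a≤2b ∨ a−b=□) ∧ (b≤2a ∨ b−a=□)}. CASES: a,b both non-square ⇒ 3b≤a ∧ 3a≤b, empty; a=α²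
& b non-square ⇒ 3b≤a ⇒ a−b=δ² (three squares δ²,α²,γ² in AP) plus 3γ²−2α²=κ₁u², 2α²+γ²=κ₂v²
(κ∈{1,3}); a,b,c all squares ⇒ α²+β²=γ², α²+3β²=κ₁u², 3α²+β²=κ₂v². Each case is a complete
intersection of three DIAGONAL quadrics in ℙ⁴ all of whose 3×3 coefficient minors are non-zero
(checked by hand for all 8 (case,κ₁,κ₂)), hence a smooth curve of genus 5, finite over ℚ by
Faltings1983Endlichkeit. So this is a THEOREM modulo citing Faltings (a grounder may restate it as
(h : Faltings…) → …); an elementary proof (2-descents on the Jacobian factors, which are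
concordant-form curves y²=x(x+r)(x+s) of conductor 2^a3^b, or a local obstruction) would make the
whole Assembly unconditional-elementary and is the interesting task. EVIDENCE: R⁺ ∩ {c ≤ 4·10^4} = ∅
(exhaustive check of 1 662 308 coprime square-top triples, planner folder check_maps.py);
conjecturally R⁺ = ∅. WHY IT MIGHT FAIL: only with Fa -/
@[route_item "route-ABC-parity-slice-concordant-norms", crux]
def SquareTopResidualFinite : Prop :=
  Set.Finite {t : ℕ × ℕ × ℕ | Literature.NumberTheory.DiophantineGeometry.IsABCTriple t.1 t.2.1 t.2.2 ∧ IsSquare t.2.2 ∧ (IsSquare t.2.1 ∨ 3 * t.2.1 ≤ t.1) ∧ (IsSquare t.1 ∨ 3 * t.1 ≤ t.2.1) ∧ (IsSquare (t.1 + 3 * t.2.1) ∨ IsSquare (3 * (t.1 + 3 * t.2.1))) ∧ (IsSquare (3 * t.1 + t.2.1) ∨ IsSquare (3 * (3 * t.1 + t.2.1))) ∧ (t.1 ≤ 2 * t.2.1 ∨ IsSquare (t.1 - t.2.1)) ∧ (t.2.1 ≤ 2 * t.1 ∨ IsSquare (t.2.1 - t.1))}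

/-- item stmt-ABC-4014 · support · rank 9 · open · by planner
sources: doi:10.1093/qmath/43.1.45, BrowningValckenborgh2012, Lichtman2025, BernertBrowningLichtmanTeravainen2024
[support] The card's unconditional per-slice almost-all theorem (P2): for each slice σ
(Squarefree(a₀b₀c₀)) and δ>0, #{abc triples (a₀x²,b₀y²,c₀z²), z ≤ Y, rad < c} ≤ C(σ,δ)·Y^(7/8+δ),
against ≍Y slice members with z ≤ Y. PROOF SKETCH (elementary; X := Y^½, (m,n) the chord parameter,
H ≍_σ X, z ≍_σ H²): with N=Q₁Q₂Q₃(m,n), |N| ≍ X⁴μ where μ=min|Q_i(m,n)| ∈ [1,X²]; a hit gives rad(N)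
≪_σ X⁴ hence P/rad(P) ≫ μ for the powerful part P of N. Points with μ ≤ X^(7/4) are ≪ X^(7/4+o(1))
(cusp regions of indefinite Q_i). For μ > X^(7/4): either some prime p > μ^(1/4) has p²|Q_i(m,n) —
(m,n) lies in one of ≤6 lattices of index p², each with ≪ X²/p²+1 PRIMITIVE points (if λ₂>2X only
±the shortest vector), total ≪ X²μ^(−1/4)+X ≪ X^(25/16); or all such p ≤ μ^(1/4) ≤ X^½ and N has a
powerful divisor q' ∈ [X^½, X^(3/2)] (greedy), whence ≪ Σ_{q' powerful} X^(o(1))(X²/q'+1) ≪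
X^(7/4+o(1)) (Σ_{q'≥Q powerful} 1/q' ≍ Q^(−½); #powerful ≤ X^(3/2) is X^(3/4)); residue classes mod
p^j at p | 2·disc·σ are O_σ(1) since v_p(Q_i(m,n)) is bounded for primitive (m,n). Constants depend
on σ (no uniformity claimed). First 'abc almost surely' statement INSIDE an N^½-size structured
family (global bounds BernertBr -/
@[route_item "route-ABC-parity-slice-concordant-norms"]
def SliceAlmostAllHits : Prop :=
  ∀ a₀ b₀ c₀ : ℕ, Squarefree (a₀ * b₀ * c₀) → ∀ δ : ℝ, 0 < δ → ∃ C : ℝ, ∀ Y : ℕ, 2 ≤ Y → (Set.ncard {t : ℕ × ℕ × ℕ | Literature.NumberTheory.DiophantineGeometry.IsABCTriple (a₀ * t.1 ^ 2) (b₀ * t.2.1 ^ 2) (c₀ * t.2.2 ^ 2) ∧ t.2.2 ≤ Y ∧ Literature.NumberTheory.DiophantineGeometry.rad (a₀ * t.1 ^ 2) (b₀ * t.2.1 ^ 2) (c₀ * t.2.2 ^ 2) < c₀ * t.2.2 ^ 2} : ℝ) ≤ C * (Y : ℝ) ^ (7 / 8 + δ)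

/-- item stmt-ABC-4016 · assembly · rank 1 · closed · proved by Summit.ABC.ABC.Theorems.paritySliceConcordantNorms_assembly @ b39756878ac2 (planner) · by planner
sources: BombieriGubler2006, Elkies1991ABCMordell, Langevin1993
[assembly] NonSquareTopABC → SquareTopResidualFinite → ABC. PROOF (elementary, provable now): fix ε
≤ 1; take C₁ from NonSquareTopABC at ε' := ε/10 and c_max := max c over the finite residual. Let
(a,b,c) be an abc triple. If c is not a square apply the Target. If (a,b,c) ∈ R⁺ then c ≤ c_max.
Otherwise one of the six conditions defining R⁺ fails, and the corresponding identity (valid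
whenever a+b=c) produces a new coprime triple (A/g, B/g, C/g), g = gcd(A,B), with NON-square top:  𝔅
[b non-square, a<3b]: A=c(2b−a)², B=a²(3b−a), C=4b³ (g | 4; top class b₀: if b even g=1, if b odd
top ∈ {4b³,2b³,b³}, none a square);  𝔅' = 𝔅 with a↔b [a non-square, b<3a];  𝔊 [a>2b, a−b
non-square]: A=a³(a−2b), B=b³(2a−b), C=c(a−b)³ (g ∈ {1,3}, g=3 iff 3|c and then v₃(C/3) is odd);  𝔊'
mirror;  ℌ [a+3b ∉ {□,3□}]: A=a(a+2b)³, B=b³(2a+3b), C=c³(a+3b) (g ∈ {1,3}, g=3 iff 3|a, top class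
(a+3b) resp. 3(a+3b));  ℌ' mirror. In every case C/g ≥ c^d/81 and rad(ABC) ≤ 18·c^(d−1)·rad(abc)
with d = 3 (𝔅) or 4 (𝔊,ℌ) (the d−1 extra linear factors are each ≤ 3c; rad is sub-multiplicative).
The Target gives c^d/81 < C₁(18 c^(d−1) rad)^(1+ε'), i.e. c^(1−(d−1)ε') < C₂·rad^(1+ε'), so c <
C₃·rad^((1+ε')/(1−3ε')) ≤ C₃·rad^ -/
@[route_item "route-ABC-parity-slice-concordant-norms", crux]
def Assembly : Prop :=
  NonSquareTopABC → SquareTopResidualFinite → ABC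

/-! D-0027 §2.1 — DECIDING THEOREM (planner-authored via `route open/edit --closes-file`; by planner-rrepair-ABC-parity-slice-concordant-no-113b9594-g2-0 2026-08-15T16:17:24Z):
its hypotheses are this route's items and its conclusion the sub-problem Statement (glue_lint), and it elaborates with this file. -/

@[closes "route-ABC-parity-slice-concordant-norms"] theorem closes (hT : NonSquareTopABC) (hR : SquareTopResidualFinite) (hA : Assembly) : _root_.ABC :=
  hA hT hR

end Summit.ABC.ABC.Theses.ParitySliceConcordantNorms
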